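import Literature.Probability.Percolation.ArmSeparationHalfStepFour
import HarnessLib

/-!
# The half-step at constant cost, at `p`: from `sepFourArmQ m N` to `sepFourArm m' N'`

Topic `Literature/Probability/Percolation`; family `crit-perc` / near-critical percolation on `𝕋`.
A brick of the near-critical arm-separation theorem for four arms of alternating colours
(P. Nolin, *Near-critical percolation in two dimensions*, EJP 13 (2008), Thm. 11 for `j = 4`,
`σ = BWBW` [arXiv 0711.4948: Thm. 10]; §4.3 Prop. 12 (i), Lemma 13; §4.4 pp. 12–13): the
probabilities of the two bends of `ArmSeparationHalfStepFour` at `q` (RSW and Harris,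
`le_real_inBent_at`, `le_real_outBent_at`), and Nolin's Lemma 13 (the generalised FKG inequality
`triSitePercolation_locallyMonotone_fkg`) packaging the deterministic half-step:
`P_p(sepFourArmQ m N) · c' ≤ P_p(sepFourArm m' N')` for `2m' + 1 ≤ m ≤ 3m'`, `4N ≤ N' ≤ 32N`, with a
constant `c'` depending only on the RSW input at `p` and at `1 - p`
(`real_sepFourArmQ_mul_le_sepFourArm_at`). Everything here is proved; no named facts are introduced.

## References

* P. Nolin, Near-critical percolation in two dimensions, *Electron. J. Probab.* 13 (2008), §4.3
  Prop. 12 (i), Lemma 13; §4.4 (arXiv 0711.4948: Prop. 11, Lemma 12; proof of Thm. 10) [Nolin2008].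
* H. Kesten, Scaling relations for 2D-percolation, *Comm. Math. Phys.* 109 (1987), Lemma 2 [Kesten1987].
-/

noncomputable section

open MeasureTheory Set

namespace Literature.Probability.Percolation

open LatticeModels

/-! ### Probabilities of the bends -/

/-- **RSW and Harris for the inner bend at `q`**: with the RSW input at `q` (aspect ratio `ρ ≥ 64`,
heights `≤ Ncap`), `P_q(inBent m m') ≥ c^97` (`1100 ≤ m'`, `2m' + 1 ≤ m ≤ 3m'`, `m ≤ Ncap`). [cite: Nolin2008, §4.3 Prop. 12 (proof) (arXiv 0711.4948: Prop. 11)] -/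
theorem le_real_inBent_at (q : unitInterval) {c : ℝ} {ρ Ncap : ℕ}
    (hrsw : ∀ k : ℕ, 1 ≤ ⌊(ρ : ℝ) * k⌋₊ → k ≤ Ncap → c ≤ triLRCrossingProb q ⌊(ρ : ℝ) * k⌋₊ k)
    (hρ : 64 ≤ ρ) (hc : 0 ≤ c) {m m' : ℕ} (hm' : 1100 ≤ m') (hmm' : 2 * m' + 1 ≤ m) (hm3 : m ≤ 3 * m') (hcap : m ≤ Ncap) :
    c ^ 97 ≤ (triSitePercolation q).real (inBent m m') := by
  classical
  have hfl : ∀ k : ℕ, ⌊(ρ : ℝ) * (k : ℕ)⌋₊ = ρ * k := fun k => by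
    have : (ρ : ℝ) * (k : ℕ) = ((ρ * k : ℕ) : ℝ) := by push_cast; ring
    rw [this, Nat.floor_natCast]
  have hcw : ∀ L k : ℕ, 1 ≤ k → k ≤ Ncap → L ≤ 64 * k → c ≤ triLRCrossingProb q L k := fun L k hk hkc hL => by
    have h := hrsw k (by rw [hfl]; nlinarith) hkc
    rw [hfl] at h
    exact h.trans (triLRCrossingProb_anti_width q (by nlinarith) k)
  have hGH : sepGlueHeight m = m - m / 4 + m / 64 := rfl
  -- the single boxes
  have hs : ∀ i ∈ Finset.range 7, c ≤ (sitePercolation (Site 2) q).real (inBentSingle m m' i) := by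
    intro i hi
    have hi' := Finset.mem_range.1 hi
    interval_cases i
    · have h1 := real_preimage_rotConfig q 1
        (triVCross ((m' : ℤ) - (m' / 8 : ℕ) + 2 + (m' / 64 : ℕ)) (-((m' / 2 : ℕ) : ℤ) - (m' / 64 : ℕ)) (m' / 8 - 3 - m' / 64) (2 * (m' / 64)))
      rw [triSitePercolation_real_triVCross] at h1
      unfold triSitePercolation at h1
      rw [inBentSingle, show {χ : SiteConfig (Site 2) | rotConfig 1 χ ∈ triVCross ((m' : ℤ) - (m' / 8 : ℕ) + 2 + (m' / 64 : ℕ))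
          (-((m' / 2 : ℕ) : ℤ) - (m' / 64 : ℕ)) (m' / 8 - 3 - m' / 64) (2 * (m' / 64))} =
        rotConfig 1 ⁻¹' triVCross ((m' : ℤ) - (m' / 8 : ℕ) + 2 + (m' / 64 : ℕ)) (-((m' / 2 : ℕ) : ℤ) - (m' / 64 : ℕ))
          (m' / 8 - 3 - m' / 64) (2 * (m' / 64)) from rfl, h1]
      exact hcw _ _ (by omega) (by omega) (by omega)
    · rw [inBentSingle, show sitePercolation (Site 2) q = triSitePercolation q from rfl, triSitePercolation_real_triVCross]
      exact hcw _ _ (by omega) (by omega) (by omega)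
    · rw [inBentSingle, show sitePercolation (Site 2) q = triSitePercolation q from rfl, triSitePercolation_real_triHCross]
      exact hcw _ _ (by omega) (by omega) (by omega)
    · rw [inBentSingle, show sitePercolation (Site 2) q = triSitePercolation q from rfl, triSitePercolation_real_triVCross]
      exact hcw _ _ (by omega) (by omega) (by omega)
    · rw [inBentSingle, show sitePercolation (Site 2) q = triSitePercolation q from rfl, triSitePercolation_real_triHCross]
      exact hcw _ _ (by omega) (by omega) (by omega)
    · rw [inBentSingle, show sitePercolation (Site 2) q = triSitePercolation q from rfl, triSitePercolation_real_triVCross]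
      exact hcw _ _ (by omega) (by omega) (by omega)
    · rw [inBentSingle, show sitePercolation (Site 2) q = triSitePercolation q from rfl, triSitePercolation_real_triHCross]
      exact hcw _ _ (by omega) (by omega) (by rw [hGH]; omega)
  have hS := sitePercolation_real_biInter_ge_prod q (Finset.range 7) (E := fun i => inBentSingle m m' i)
    (F := fun i => inBentSingleF m m' i) (fun i hi => determinedBy_inBentSingle m m' (Finset.mem_range.1 hi))
    (fun i hi => isUpperSet_inBentSingle m m' (Finset.mem_range.1 hi))
  have hS7 : c ^ 7 ≤ (sitePercolation (Site 2) q).real (⋂ i ∈ Finset.range 7, inBentSingle m m' i) := by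
    calc c ^ 7 = ∏ _i ∈ Finset.range 7, c := by rw [Finset.prod_const, Finset.card_range]
      _ ≤ ∏ i ∈ Finset.range 7, (sitePercolation (Site 2) q).real (inBentSingle m m' i) :=
          Finset.prod_le_prod (fun _ _ => hc) hs
      _ ≤ _ := hS
  -- the comb
  have eG : c ^ 90 ≤ (sitePercolation (Site 2) q).real (⋂ i ∈ Finset.range 90, inCombB m i) := by
    have hprod := sitePercolation_real_biInter_ge_prod q (Finset.range 90) (E := fun i => inCombB m i)
      (F := fun i => inCombBF m i) (fun i _ => determinedBy_triVCross _ _ _ _) (fun i _ => isUpperSet_triVCross _ _ _ _)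
    have heach : ∀ i ∈ Finset.range 90, c ≤ (sitePercolation (Site 2) q).real (inCombB m i) := fun i _ => by
      rw [inCombB, show sitePercolation (Site 2) q = triSitePercolation q from rfl, triSitePercolation_real_triVCross]
      exact hcw _ _ (by omega) (by omega) (by omega)
    have hle : c ^ 90 ≤ ∏ i ∈ Finset.range 90, (sitePercolation (Site 2) q).real (inCombB m i) := by
      calc c ^ 90 = ∏ _i ∈ Finset.range 90, c := by rw [Finset.prod_const, Finset.card_range]
        _ ≤ _ := Finset.prod_le_prod (fun _ _ => hc) heach
    exact hle.trans hprod
  have dS : DeterminedBy (⋂ i ∈ Finset.range 7, inBentSingle m m' i) ↑((Finset.range 7).biUnion (inBentSingleF m m')) :=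
    DeterminedBy.biInter_finset (Finset.range 7) (E := fun i => inBentSingle m m' i) (F := fun i => inBentSingleF m m' i)
      fun i hi => determinedBy_inBentSingle m m' (Finset.mem_range.1 hi)
  have dG : DeterminedBy (⋂ i ∈ Finset.range 90, inCombB m i) ↑((Finset.range 90).biUnion (inCombBF m)) :=
    DeterminedBy.biInter_finset (Finset.range 90) (E := fun i => inCombB m i) (F := fun i => inCombBF m i)
      fun i _ => determinedBy_triVCross _ _ _ _
  have uS : IsUpperSet (⋂ i ∈ Finset.range 7, inBentSingle m m' i) :=
    isUpperSet_iInter₂ fun i hi => isUpperSet_inBentSingle m m' (Finset.mem_range.1 hi)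
  have uG : IsUpperSet (⋂ i ∈ Finset.range 90, inCombB m i) := isUpperSet_iInter₂ fun i _ => isUpperSet_triVCross _ _ _ _
  have har := sitePercolation_harris' q dS dG uS uG
  unfold triSitePercolation
  rw [inBent_eq]
  calc c ^ 97 = c ^ 7 * c ^ 90 := by ring
    _ ≤ _ := (mul_le_mul hS7 eG (pow_nonneg hc _) measureReal_nonneg).trans har

/-- **RSW and Harris for the bent corridor at `q`, cap on the box heights only** (the variant of
`le_real_sepOutCorrQ_at` with `R' ≤ 2 Ncap`: all `95` boxes have height `≤ R'/8`): if
`c ≤ P_q(long-way crossing of [0, ⌊ρ k⌋] × [0, k])` for `1 ≤ k ≤ Ncap` (`ρ ≥ 64`, `c ≥ 0`), then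
`P_q(sepOutCorrQ R R') ≥ c^95` for `2200 ≤ R`, `2R ≤ R' ≤ 32R`, `R' ≤ 2 Ncap`. [cite: Nolin2008, §4.3 Prop. 12 (proof) (arXiv 0711.4948: Prop. 11)] -/
theorem le_real_sepOutCorrQ_at' (q : unitInterval) {c : ℝ} {ρ Ncap : ℕ}
    (hrsw : ∀ k : ℕ, 1 ≤ ⌊(ρ : ℝ) * k⌋₊ → k ≤ Ncap → c ≤ triLRCrossingProb q ⌊(ρ : ℝ) * k⌋₊ k)
    (hρ : 64 ≤ ρ) (hc : 0 ≤ c) {R R' : ℕ} (hR : 2200 ≤ R) (hRR' : 2 * R ≤ R') (hR'R : R' ≤ 32 * R) (hcap : R' ≤ 2 * Ncap) :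
    c ^ 95 ≤ (triSitePercolation q).real (sepOutCorrQ R R') := by
  classical
  have hfl : ∀ k : ℕ, ⌊(ρ : ℝ) * (k : ℕ)⌋₊ = ρ * k := fun k => by
    have : (ρ : ℝ) * (k : ℕ) = ((ρ * k : ℕ) : ℝ) := by push_cast; ring
    rw [this, Nat.floor_natCast]
  have hcw : ∀ L k : ℕ, 1 ≤ k → k ≤ Ncap → L ≤ 64 * k → c ≤ triLRCrossingProb q L k := fun L k hk hkc hL => by
    have h := hrsw k (by rw [hfl]; nlinarith) hkc
    rw [hfl] at h
    exact h.trans (triLRCrossingProb_anti_width q (by nlinarith) k)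
  set E1 := triVCross ((R' : ℤ) + 1) (-((R' / 2 : ℕ) : ℤ) - (R' / 64 : ℕ)) (R' / 16 - 1) (2 * (R' / 64)) with hE1
  set E2 := triHCross ((R' : ℤ) - (R' / 16 : ℕ)) (-((R' / 2 : ℕ) : ℤ)) (2 * (R' / 16)) (R' / 64) with hE2
  set E3 := triVCross ((R' : ℤ) - (R' / 16 : ℕ)) (-((R' / 2 : ℕ) : ℤ)) (R' / 16 - 1) (R' / 2 - R / 2 + R' / 64) with hE3
  set E4 := triHCross ((R : ℤ) + (R / 8 : ℕ) + 1) (-((R / 2 : ℕ) : ℤ)) (R' - (R + R / 8 + 1)) (R' / 64) with hE4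
  set E5 := triVCross ((R : ℤ) + (R / 8 : ℕ) + 1) (-(sepGlueHeight R : ℤ)) (R / 8) (sepGlueHeight R) with hE5
  set G := ⋂ i ∈ Finset.range 90, sepOutComb R i with hG
  set F := sepOutCorrQFinset R R' with hF
  have c1 : (↑(triStripFinset ((R' : ℤ) + 1) (-((R' / 2 : ℕ) : ℤ) - (R' / 64 : ℕ)) (R' / 16 - 1) (2 * (R' / 64))) : Set (Site 2)) ⊆ ↑F :=
    Finset.coe_subset.2 (Finset.subset_union_left.trans (Finset.subset_union_left.trans (Finset.subset_union_left.trans (Finset.subset_union_left.trans Finset.subset_union_left))))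
  have c2 : (↑(triStripFinset ((R' : ℤ) - (R' / 16 : ℕ)) (-((R' / 2 : ℕ) : ℤ)) (2 * (R' / 16)) (R' / 64)) : Set (Site 2)) ⊆ ↑F :=
    Finset.coe_subset.2 (Finset.subset_union_right.trans (Finset.subset_union_left.trans (Finset.subset_union_left.trans (Finset.subset_union_left.trans Finset.subset_union_left))))
  have c3 : (↑(triStripFinset ((R' : ℤ) - (R' / 16 : ℕ)) (-((R' / 2 : ℕ) : ℤ)) (R' / 16 - 1) (R' / 2 - R / 2 + R' / 64)) : Set (Site 2)) ⊆ ↑F :=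
    Finset.coe_subset.2 (Finset.subset_union_right.trans (Finset.subset_union_left.trans (Finset.subset_union_left.trans Finset.subset_union_left)))
  have c4 : (↑(triStripFinset ((R : ℤ) + (R / 8 : ℕ) + 1) (-((R / 2 : ℕ) : ℤ)) (R' - (R + R / 8 + 1)) (R' / 64)) : Set (Site 2)) ⊆ ↑F :=
    Finset.coe_subset.2 (Finset.subset_union_right.trans (Finset.subset_union_left.trans Finset.subset_union_left))
  have c5 : (↑(triStripFinset ((R : ℤ) + (R / 8 : ℕ) + 1) (-(sepGlueHeight R : ℤ)) (R / 8) (sepGlueHeight R)) : Set (Site 2)) ⊆ ↑F :=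
    Finset.coe_subset.2 (Finset.subset_union_right.trans Finset.subset_union_left)
  have c6 : (↑((Finset.range 90).biUnion fun i : ℕ =>
      triStripFinset ((R : ℤ) + 1) (-(sepGlueHeight R : ℤ) + i * ((R / 64 / 2 : ℕ) : ℤ)) (2 * (R / 8)) (R / 64 / 2)) :
        Set (Site 2)) ⊆ ↑F :=
    Finset.coe_subset.2 (Finset.subset_union_right)
  have d1 : DeterminedBy E1 ↑F := (determinedBy_triVCross _ _ _ _).mono c1
  have d2 : DeterminedBy E2 ↑F := (determinedBy_triHCross _ _ _ _).mono c2
  have d3 : DeterminedBy E3 ↑F := (determinedBy_triVCross _ _ _ _).mono c3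
  have d4 : DeterminedBy E4 ↑F := (determinedBy_triHCross _ _ _ _).mono c4
  have d5 : DeterminedBy E5 ↑F := (determinedBy_triVCross _ _ _ _).mono c5
  have dG : DeterminedBy G ↑F := (DeterminedBy.biInter_finset (Finset.range 90) (E := fun i => sepOutComb R i)
    (F := fun i : ℕ => triStripFinset ((R : ℤ) + 1) (-(sepGlueHeight R : ℤ) + i * ((R / 64 / 2 : ℕ) : ℤ)) (2 * (R / 8)) (R / 64 / 2))
    fun i _ => determinedBy_triHCross _ _ _ _).mono c6
  have u1 : IsUpperSet E1 := isUpperSet_triVCross _ _ _ _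
  have u2 : IsUpperSet E2 := isUpperSet_triHCross _ _ _ _
  have u3 : IsUpperSet E3 := isUpperSet_triVCross _ _ _ _
  have u4 : IsUpperSet E4 := isUpperSet_triHCross _ _ _ _
  have u5 : IsUpperSet E5 := isUpperSet_triVCross _ _ _ _
  have uG : IsUpperSet G := isUpperSet_iInter₂ fun i _ => isUpperSet_triHCross _ _ _ _
  have hGH : sepGlueHeight R = R - R / 4 + R / 64 := rfl
  have e1 : c ≤ (triSitePercolation q).real E1 := by
    rw [hE1, triSitePercolation_real_triVCross]; exact hcw _ _ (by omega) (by omega) (by omega)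
  have e2 : c ≤ (triSitePercolation q).real E2 := by
    rw [hE2, triSitePercolation_real_triHCross]; exact hcw _ _ (by omega) (by omega) (by omega)
  have e3 : c ≤ (triSitePercolation q).real E3 := by
    rw [hE3, triSitePercolation_real_triVCross]; exact hcw _ _ (by omega) (by omega) (by omega)
  have e4 : c ≤ (triSitePercolation q).real E4 := by
    rw [hE4, triSitePercolation_real_triHCross]; exact hcw _ _ (by omega) (by omega) (by omega)
  have e5 : c ≤ (triSitePercolation q).real E5 := by
    rw [hE5, triSitePercolation_real_triVCross]; exact hcw _ _ (by omega) (by omega) (by rw [hGH]; omega)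
  have eG : c ^ 90 ≤ (triSitePercolation q).real G := by
    have hprod := sitePercolation_real_biInter_ge_prod q (Finset.range 90) (E := fun i => sepOutComb R i)
      (F := fun i => triStripFinset ((R : ℤ) + 1) (-(sepGlueHeight R : ℤ) + i * ((R / 64 / 2 : ℕ) : ℤ)) (2 * (R / 8)) (R / 64 / 2))
      (fun i _ => determinedBy_triHCross _ _ _ _) (fun i _ => isUpperSet_triHCross _ _ _ _)
    have heach : ∀ i ∈ Finset.range 90, c ≤ (sitePercolation (Site 2) q).real (sepOutComb R i) := fun i _ => by
      have := triSitePercolation_real_triHCross q ((R : ℤ) + 1)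
        (-(sepGlueHeight R : ℤ) + i * ((R / 64 / 2 : ℕ) : ℤ)) (2 * (R / 8)) (R / 64 / 2)
      unfold triSitePercolation at this
      rw [sepOutComb, this]
      exact hcw _ _ (by omega) (by omega) (by omega)
    have hle : c ^ 90 ≤ ∏ i ∈ Finset.range 90, (sitePercolation (Site 2) q).real (sepOutComb R i) := by
      calc c ^ 90 = ∏ _i ∈ Finset.range 90, c := by rw [Finset.prod_const, Finset.card_range]
        _ ≤ _ := Finset.prod_le_prod (fun _ _ => hc) heach
    unfold triSitePercolation
    exact hle.trans hprod
  have h12 := sitePercolation_harris q d1 d2 u1 u2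
  have h123 := sitePercolation_harris q (d1.inter d2) d3 (u1.inter u2) u3
  have h1234 := sitePercolation_harris q ((d1.inter d2).inter d3) d4 ((u1.inter u2).inter u3) u4
  have h12345 := sitePercolation_harris q (((d1.inter d2).inter d3).inter d4) d5 (((u1.inter u2).inter u3).inter u4) u5
  have h123456 := sitePercolation_harris q ((((d1.inter d2).inter d3).inter d4).inter d5) dG
    ((((u1.inter u2).inter u3).inter u4).inter u5) uG
  have hdef : sepOutCorrQ R R' = E1 ∩ E2 ∩ E3 ∩ E4 ∩ E5 ∩ G := rfl
  unfold triSitePercolation at e1 e2 e3 e4 e5 eG ⊢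
  rw [hdef]
  set μ := sitePercolation (Site 2) q with hμ
  have h0 : ∀ s, 0 ≤ μ.real s := fun s => measureReal_nonneg
  calc c ^ 95 = c * c * c * c * c * c ^ 90 := by ring
    _ ≤ μ.real E1 * μ.real E2 * μ.real E3 * μ.real E4 * μ.real E5 * μ.real G := by
        have t2 := mul_le_mul e1 e2 hc (h0 _)
        have t3 := mul_le_mul t2 e3 hc (mul_nonneg (h0 _) (h0 _))
        have t4 := mul_le_mul t3 e4 hc (mul_nonneg (mul_nonneg (h0 _) (h0 _)) (h0 _))
        have t5 := mul_le_mul t4 e5 hc (mul_nonneg (mul_nonneg (mul_nonneg (h0 _) (h0 _)) (h0 _)) (h0 _))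
        exact mul_le_mul t5 eG (pow_nonneg hc _) (mul_nonneg (mul_nonneg (mul_nonneg (mul_nonneg (h0 _) (h0 _)) (h0 _)) (h0 _)) (h0 _))
    _ ≤ μ.real (E1 ∩ E2) * μ.real E3 * μ.real E4 * μ.real E5 * μ.real G :=
        mul_le_mul_of_nonneg_right (mul_le_mul_of_nonneg_right (mul_le_mul_of_nonneg_right
          (mul_le_mul_of_nonneg_right h12 (h0 _)) (h0 _)) (h0 _)) (h0 _)
    _ ≤ μ.real (E1 ∩ E2 ∩ E3) * μ.real E4 * μ.real E5 * μ.real G :=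
        mul_le_mul_of_nonneg_right (mul_le_mul_of_nonneg_right (mul_le_mul_of_nonneg_right h123 (h0 _)) (h0 _)) (h0 _)
    _ ≤ μ.real (E1 ∩ E2 ∩ E3 ∩ E4) * μ.real E5 * μ.real G :=
        mul_le_mul_of_nonneg_right (mul_le_mul_of_nonneg_right h1234 (h0 _)) (h0 _)
    _ ≤ μ.real (E1 ∩ E2 ∩ E3 ∩ E4 ∩ E5) * μ.real G := mul_le_mul_of_nonneg_right h12345 (h0 _)
    _ ≤ μ.real (E1 ∩ E2 ∩ E3 ∩ E4 ∩ E5 ∩ G) := h123456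

/-! ### The extension inequality -/

/-- **RSW and Harris for the outer bend at `q`**: `P_q(outBent N N') ≥ c^95` (`2200 ≤ N`,
`4N ≤ N' ≤ 32N`, `N' ≤ 2 Ncap` — all boxes have height `≤ N'/8` —, aspect ratio `ρ ≥ 64`). [cite: Nolin2008, §4.3 Prop. 12 (proof) (arXiv 0711.4948: Prop. 11)] -/
theorem le_real_outBent_at (q : unitInterval) {c : ℝ} {ρ Ncap : ℕ}
    (hrsw : ∀ k : ℕ, 1 ≤ ⌊(ρ : ℝ) * k⌋₊ → k ≤ Ncap → c ≤ triLRCrossingProb q ⌊(ρ : ℝ) * k⌋₊ k)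
    (hρ : 64 ≤ ρ) (hc : 0 ≤ c) {N N' : ℕ} (hN : 2200 ≤ N) (hNN' : 4 * N ≤ N') (hN'N : N' ≤ 32 * N) (hcap : N' ≤ 2 * Ncap) :
    c ^ 95 ≤ (triSitePercolation q).real (outBent N N') := by
  classical
  have hfl : ∀ k : ℕ, ⌊(ρ : ℝ) * (k : ℕ)⌋₊ = ρ * k := fun k => by
    have : (ρ : ℝ) * (k : ℕ) = ((ρ * k : ℕ) : ℝ) := by push_cast; ring
    rw [this, Nat.floor_natCast]
  have hcw : ∀ L k : ℕ, 1 ≤ k → k ≤ Ncap → L ≤ 64 * k → c ≤ triLRCrossingProb q L k := fun L k hk hkc hL => by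
    have h := hrsw k (by rw [hfl]; nlinarith) hkc
    rw [hfl] at h
    exact h.trans (triLRCrossingProb_anti_width q (by nlinarith) k)
  have hGH : sepGlueHeight N = N - N / 4 + N / 64 := rfl
  have hs : ∀ i ∈ Finset.range 5, c ≤ (sitePercolation (Site 2) q).real (outBentSingle N N' i) := by
    intro i hi
    have hi' := Finset.mem_range.1 hi
    interval_cases i
    · have h1 := real_preimage_rotConfig q 1
        (triVCross ((N' : ℤ) + 1) (-((N' / 2 : ℕ) : ℤ) - (N' / 64 : ℕ)) (N' / 16 - 1) (2 * (N' / 64)))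
      rw [triSitePercolation_real_triVCross] at h1
      unfold triSitePercolation at h1
      rw [outBentSingle, show {χ : SiteConfig (Site 2) | rotConfig 1 χ ∈ triVCross ((N' : ℤ) + 1) (-((N' / 2 : ℕ) : ℤ) - (N' / 64 : ℕ))
          (N' / 16 - 1) (2 * (N' / 64))} =
        rotConfig 1 ⁻¹' triVCross ((N' : ℤ) + 1) (-((N' / 2 : ℕ) : ℤ) - (N' / 64 : ℕ)) (N' / 16 - 1) (2 * (N' / 64)) from rfl, h1]
      exact hcw _ _ (by omega) (by omega) (by omega)
    · rw [outBentSingle, show sitePercolation (Site 2) q = triSitePercolation q from rfl, triSitePercolation_real_triVCross]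
      exact hcw _ _ (by omega) (by omega) (by omega)
    · rw [outBentSingle, show sitePercolation (Site 2) q = triSitePercolation q from rfl, triSitePercolation_real_triHCross]
      exact hcw _ _ (by omega) (by omega) (by omega)
    · rw [outBentSingle, show sitePercolation (Site 2) q = triSitePercolation q from rfl, triSitePercolation_real_triVCross]
      exact hcw _ _ (by omega) (by omega) (by omega)
    · rw [outBentSingle, show sitePercolation (Site 2) q = triSitePercolation q from rfl, triSitePercolation_real_triHCross]
      exact hcw _ _ (by omega) (by omega) (by rw [hGH]; omega)
  have hS := sitePercolation_real_biInter_ge_prod q (Finset.range 5) (E := fun i => outBentSingle N N' i)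
    (F := fun i => outBentSingleF N N' i) (fun i hi => determinedBy_outBentSingle N N' (Finset.mem_range.1 hi))
    (fun i hi => isUpperSet_outBentSingle N N' (Finset.mem_range.1 hi))
  have hS5 : c ^ 5 ≤ (sitePercolation (Site 2) q).real (⋂ i ∈ Finset.range 5, outBentSingle N N' i) := by
    calc c ^ 5 = ∏ _i ∈ Finset.range 5, c := by rw [Finset.prod_const, Finset.card_range]
      _ ≤ ∏ i ∈ Finset.range 5, (sitePercolation (Site 2) q).real (outBentSingle N N' i) :=
          Finset.prod_le_prod (fun _ _ => hc) hs
      _ ≤ _ := hS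
  have eG : c ^ 90 ≤ (sitePercolation (Site 2) q).real (⋂ j ∈ Finset.range 90, outCombB N j) := by
    have hprod := sitePercolation_real_biInter_ge_prod q (Finset.range 90) (E := fun j => outCombB N j)
      (F := fun j => outCombBF N j) (fun j _ => determinedBy_triVCross _ _ _ _) (fun j _ => isUpperSet_triVCross _ _ _ _)
    have heach : ∀ j ∈ Finset.range 90, c ≤ (sitePercolation (Site 2) q).real (outCombB N j) := fun j _ => by
      rw [outCombB, show sitePercolation (Site 2) q = triSitePercolation q from rfl, triSitePercolation_real_triVCross]
      exact hcw _ _ (by omega) (by omega) (by omega)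
    have hle : c ^ 90 ≤ ∏ j ∈ Finset.range 90, (sitePercolation (Site 2) q).real (outCombB N j) := by
      calc c ^ 90 = ∏ _i ∈ Finset.range 90, c := by rw [Finset.prod_const, Finset.card_range]
        _ ≤ _ := Finset.prod_le_prod (fun _ _ => hc) heach
    exact hle.trans hprod
  have dS : DeterminedBy (⋂ i ∈ Finset.range 5, outBentSingle N N' i) ↑((Finset.range 5).biUnion (outBentSingleF N N')) :=
    DeterminedBy.biInter_finset (Finset.range 5) (E := fun i => outBentSingle N N' i) (F := fun i => outBentSingleF N N' i)
      fun i hi => determinedBy_outBentSingle N N' (Finset.mem_range.1 hi)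
  have dG : DeterminedBy (⋂ j ∈ Finset.range 90, outCombB N j) ↑((Finset.range 90).biUnion (outCombBF N)) :=
    DeterminedBy.biInter_finset (Finset.range 90) (E := fun j => outCombB N j) (F := fun j => outCombBF N j)
      fun j _ => determinedBy_triVCross _ _ _ _
  have uS : IsUpperSet (⋂ i ∈ Finset.range 5, outBentSingle N N' i) :=
    isUpperSet_iInter₂ fun i hi => isUpperSet_outBentSingle N N' (Finset.mem_range.1 hi)
  have uG : IsUpperSet (⋂ j ∈ Finset.range 90, outCombB N j) := isUpperSet_iInter₂ fun j _ => isUpperSet_triVCross _ _ _ _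
  have har := sitePercolation_harris' q dS dG uS uG
  unfold triSitePercolation
  rw [outBent_eq]
  calc c ^ 95 = c ^ 5 * c ^ 90 := by ring
    _ ≤ _ := (mul_le_mul hS5 eG (pow_nonneg hc _) measureReal_nonneg).trans har

/-! ### Frame and rotation identities -/

/-- `frameConfig 3 = rotConfig 3` (both read through the central symmetry). [folklore] -/
theorem frameConfig_three_eq_rotConfig (ω : SiteConfig (Site 2)) : frameConfig 3 ω = rotConfig 3 ω := by
  ext v
  rw [mem_frameConfig, mem_rotConfig]
  obtain ⟨-, -, -, -, -, -, f30, f31, -⟩ := frameIso_apply_formula v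
  obtain ⟨-, -, -, -, -, -, r30, r31, -⟩ := rot_apply_formula v
  rw [show frameIso 3 v = triRotIsoPow 3 v from Site.eq_iff_two.2 ⟨by rw [f30, r30], by rw [f31, r31]⟩]

/-- `frameConfig 5 χ = frameConfig 2 (rotConfig 3 χ)`. [folklore] -/
theorem frameConfig_five_eq (χ : SiteConfig (Site 2)) : frameConfig 5 χ = frameConfig 2 (rotConfig 3 χ) := by
  ext v
  rw [mem_frameConfig, mem_frameConfig, mem_rotConfig]
  obtain ⟨-, -, -, -, f20, f21, -, -, -, -, f50, f51⟩ := frameIso_apply_formula v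
  obtain ⟨-, -, -, -, -, -, r30, r31, -⟩ := rot_apply_formula (frameIso 2 v)
  rw [show frameIso 5 v = triRotIsoPow 3 (frameIso 2 v) from Site.eq_iff_two.2 ⟨by rw [f50, r30, f20], by rw [f51, r31, f21]⟩]

/-- `rotConfig 1 ∘ rotConfig 3 = rotConfig 4`. [folklore] -/
theorem rotConfig_one_three (χ : SiteConfig (Site 2)) : rotConfig 1 (rotConfig 3 χ) = rotConfig 4 χ := by
  ext v
  rw [mem_rotConfig, mem_rotConfig, show (4 : ℕ) = 1 + 3 from rfl, mem_rotConfig_add, mem_rotConfig]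

/-- `rotConfig 0 = id`. [folklore] -/
theorem rotConfig_zero_eq (ω : SiteConfig (Site 2)) : rotConfig 0 ω = ω := by
  ext v; rw [mem_rotConfig, triRotIsoPow_zero_apply]

/-! ### The half-step at constant cost -/

set_option maxHeartbeats 1600000 in
/-- **The half-step at constant cost, at `p`** (Nolin 2008, Prop. 12 (i) at both ends via Lemma 13,
§4.4 pp. 12–13): with the RSW input `hrsw` at `p` and at `1 - p` (aspect ratio `ρ ≥ 256`, heights
`≤ Ncap`), for `1100 ≤ m'`, `2m' + 1 ≤ m ≤ 3m'`, `2200 ≤ N`, `2m ≤ N`, `4N ≤ N' ≤ 32N`, `N' ≤ 2 Ncap`: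
`P_p(sepFourArmQ m N) · ((c^93 c^95)² (c^97 c^95)²) ≤ P_p(sepFourArm m' N')`. The generalised FKG
inequality `triSitePercolation_locallyMonotone_fkg` with the shared shell `{m ≤ |v| ≤ N}`, the
increasing region (off the shell, sectors of the sides `0, 3`: the open arms' free spaces and their
corridors `sepInCorrQ`, `sepOutCorrQ`) and the decreasing region (off the shell, sectors of the sides
`1, 2, 4, 5`: the closed arms' free spaces and their bends `inBent`, `outBent`), Harris at `p` and at
`1 - p`, the deterministic half-step (`openArm_halfStep`, `closedArm_halfStep`) and the conversion
`sepFourArm_of_arms`. [cite: Nolin2008, §4.3 Prop. 12 (i) and Lemma 13 (arXiv 0711.4948: Prop. 11, Lemma 12); §4.4 pp. 12–13] -/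
theorem real_sepFourArmQ_mul_le_sepFourArm_at (p : unitInterval) {c : ℝ} {ρ Ncap : ℕ}
    (hrsw : ∀ q : unitInterval, (q = p ∨ q = unitInterval.symm p) →
      ∀ k : ℕ, 1 ≤ ⌊(ρ : ℝ) * k⌋₊ → k ≤ Ncap → c ≤ triLRCrossingProb q ⌊(ρ : ℝ) * k⌋₊ k)
    (hρ : 256 ≤ ρ) (hc : 0 ≤ c) {m m' N N' : ℕ} (hm' : 1100 ≤ m') (hmm' : 2 * m' + 1 ≤ m) (hm3 : m ≤ 3 * m')
    (hN : 2200 ≤ N) (hmN : 2 * m ≤ N) (hNN' : 4 * N ≤ N') (hN'N : N' ≤ 32 * N) (hcap : N' ≤ 2 * Ncap) :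
    (triSitePercolation p).real (sepFourArmQ m N) * ((c ^ 93 * c ^ 95) ^ 2 * (c ^ 97 * c ^ 95) ^ 2) ≤
      (triSitePercolation p).real (sepFourArm m' N') := by
  classical
  -- the three pairwise disjoint regions of Nolin's Lemma 13
  set S : Finset (Site 2) := (triBall N).filter (fun v => (m : ℤ) ≤ triNorm v) with hS
  set P : Finset (Site 2) := (triBall (N' + N' / 8)).filter
    (fun v => (triNorm v < (m : ℤ) ∨ (N : ℤ) < triNorm v) ∧ ((v 1 ≤ 0 ∧ 0 < v 0 + v 1) ∨ (0 ≤ v 1 ∧ v 0 + v 1 < 0))) with hP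
  set M : Finset (Site 2) := (triBall (N' + N' / 8)).filter
    (fun v => (triNorm v < (m : ℤ) ∨ (N : ℤ) < triNorm v) ∧
      ((0 ≤ v 0 ∧ 0 < v 1) ∨ (v 0 < 0 ∧ 0 ≤ v 0 + v 1) ∨ (v 0 ≤ 0 ∧ v 1 < 0) ∨ (0 < v 0 ∧ v 0 + v 1 ≤ 0))) with hM
  have hSP : Disjoint S P := by
    rw [Finset.disjoint_left]; intro v hvS hvP
    simp only [hS, hP, Finset.mem_filter, mem_triBall_iff] at hvS hvP
    omega
  have hSM : Disjoint S M := by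
    rw [Finset.disjoint_left]; intro v hvS hvM
    simp only [hS, hM, Finset.mem_filter, mem_triBall_iff] at hvS hvM
    omega
  have hPM : Disjoint P M := by
    rw [Finset.disjoint_left]; intro v hvP hvM
    simp only [hP, hM, Finset.mem_filter] at hvP hvM
    omega
  have hmNz : 2 * (m : ℤ) ≤ N := by exact_mod_cast hmN
  have hNN : 4 * (N : ℤ) ≤ N' := by exact_mod_cast hNN'
  have h88 : (N : ℤ) + (N / 8 : ℕ) ≤ (N' : ℤ) + (N' / 8 : ℕ) := by omega
  have hm88 : (m : ℤ) ≤ (N' : ℤ) + (N' / 8 : ℕ) := by omega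
  -- supports of the arms
  have coneSup : ∀ (i : ℕ) (hi : i < 6), (i = 0 ∨ i = 3 → frameIso i '' sepConeSupport m N ⊆ ↑S ∪ ↑P) ∧
      (i = 2 ∨ i = 5 → frameIso i '' sepConeSupport m N ⊆ ↑S ∪ ↑M) := by
    intro i hi
    constructor
    · rintro hi0 v ⟨u, hu, rfl⟩
      rw [mem_sepConeSupport] at hu
      obtain ⟨f00, f01, -, -, -, -, f30, f31, -⟩ := frameIso_apply_formula u
      simp only [hS, hP, Set.mem_union, Finset.mem_coe, Finset.mem_filter, mem_triBall_iff, triNorm_frameIso i hi]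
      by_cases h : (m : ℤ) ≤ triNorm u ∧ triNorm u ≤ (N : ℤ)
      · left; exact ⟨h.2, h.1⟩
      · right
        have hor : triNorm u < (m : ℤ) ∨ (N : ℤ) < triNorm u := by omega
        have hc := hu.2.2 hor
        refine ⟨by omega, hor, ?_⟩
        rcases hi0 with rfl | rfl
        · left; rw [f00, f01]; omega
        · right; rw [f30, f31]; omega
    · rintro hi2 v ⟨u, hu, rfl⟩
      rw [mem_sepConeSupport] at hu
      obtain ⟨-, -, -, -, f20, f21, -, -, -, -, f50, f51⟩ := frameIso_apply_formula u
      simp only [hS, hM, Set.mem_union, Finset.mem_coe, Finset.mem_filter, mem_triBall_iff, triNorm_frameIso i hi]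
      by_cases h : (m : ℤ) ≤ triNorm u ∧ triNorm u ≤ (N : ℤ)
      · left; exact ⟨h.2, h.1⟩
      · right
        have hor : triNorm u < (m : ℤ) ∨ (N : ℤ) < triNorm u := by omega
        have hc := hu.2.2 hor
        refine ⟨by omega, hor, ?_⟩
        rcases hi2 with rfl | rfl
        · right; left; rw [f20, f21]; omega
        · right; right; right; rw [f50, f51]; omega
  -- supports of the open corridors
  have inSup : ∀ (i : ℕ) (hi : i < 6), i = 0 ∨ i = 3 → frameIso i '' ↑(sepInCorrQFinset m m') ⊆ ↑P := by
    rintro i hi hi0 v ⟨u, hu, rfl⟩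
    have h := sepInCorrQFinset_subset (by omega) hmm' hm3 (by omega) (Finset.mem_coe.1 hu)
    obtain ⟨f00, f01, -, -, -, -, f30, f31, -⟩ := frameIso_apply_formula u
    simp only [hP, Finset.mem_coe, Finset.mem_filter, mem_triBall_iff, triNorm_frameIso i hi]
    refine ⟨by omega, Or.inl h.1, ?_⟩
    rcases hi0 with rfl | rfl
    · left; rw [f00, f01]; omega
    · right; rw [f30, f31]; omega
  have outSup : ∀ (i : ℕ) (hi : i < 6), i = 0 ∨ i = 3 → frameIso i '' ↑(sepOutCorrQFinset N N') ⊆ ↑P := by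
    rintro i hi hi0 v ⟨u, hu, rfl⟩
    have h := sepOutCorrQFinset_subset hN (by omega) hN'N (Finset.mem_coe.1 hu)
    obtain ⟨f00, f01, -, -, -, -, f30, f31, -⟩ := frameIso_apply_formula u
    simp only [hP, Finset.mem_coe, Finset.mem_filter, mem_triBall_iff, triNorm_frameIso i hi]
    refine ⟨h.2.1, Or.inr h.1, ?_⟩
    rcases hi0 with rfl | rfl
    · left; rw [f00, f01]; omega
    · right; rw [f30, f31]; omega
  -- supports of the bends of the closed arms (identity and half-turn)
  have bendSup0 : (↑(inBentFinset m m') : Set (Site 2)) ∪ ↑(outBentFinset N N') ⊆ ↑M := by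
    rintro v (hv | hv)
    · have h := inBentFinset_subset hm' hmm' hm3 (Finset.mem_coe.1 hv)
      simp only [hM, Finset.mem_coe, Finset.mem_filter, mem_triBall_iff]
      exact ⟨by omega, Or.inl h.1, by omega⟩
    · have h := outBentFinset_subset hN hNN' hN'N (Finset.mem_coe.1 hv)
      simp only [hM, Finset.mem_coe, Finset.mem_filter, mem_triBall_iff]
      exact ⟨h.2.1, Or.inr h.1, by omega⟩
  have bendSup3 : triRotIsoPow 3 '' ((↑(inBentFinset m m') : Set (Site 2)) ∪ ↑(outBentFinset N N')) ⊆ ↑M := by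
    rintro _ ⟨u, hu, rfl⟩
    obtain ⟨-, -, -, -, -, -, r30, r31, -⟩ := rot_apply_formula u
    simp only [hM, Finset.mem_coe, Finset.mem_filter, mem_triBall_iff, triNorm_rot 3 u]
    rw [show ((triRotIsoPow 3 : triGraph ≃g triGraph) u) = triRotIsoPow 3 u from rfl, r30, r31]
    rcases hu with hu | hu
    · have h := inBentFinset_subset hm' hmm' hm3 (Finset.mem_coe.1 hu)
      exact ⟨by omega, Or.inl h.1, by omega⟩
    · have h := outBentFinset_subset hN hNN' hN'N (Finset.mem_coe.1 hu)
      exact ⟨h.2.1, Or.inr h.1, by omega⟩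
  -- the events
  set E := sepOpenArm m N with hE
  set C := sepInCorrQ m m' ∩ sepOutCorrQ N N' with hC
  set Bt := inBent m m' ∩ outBent N N' with hBt
  set Ap : Set (SiteConfig (Site 2)) := E ∩ {ω | frameConfig 3 ω ∈ E} with hAp
  set Am : Set (SiteConfig (Site 2)) := {ω | frameConfig 2 ωᶜ ∈ E} ∩ {ω | frameConfig 5 ωᶜ ∈ E} with hAm
  set Bp : Set (SiteConfig (Site 2)) := C ∩ {ω | frameConfig 3 ω ∈ C} with hBp
  set Bm : Set (SiteConfig (Site 2)) := {ω | ωᶜ ∈ Bt} ∩ {ω | (rotConfig 3 ω)ᶜ ∈ Bt} with hBm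
  have huE : IsUpperSet E := isUpperSet_sepOpenArm m N
  have huC : IsUpperSet C := (isUpperSet_sepInCorrQ m m').inter (isUpperSet_sepOutCorrQ N N')
  have huBt : IsUpperSet Bt := (isUpperSet_inBent m m').inter (isUpperSet_outBent N N')
  have upre : ∀ {F : Set (SiteConfig (Site 2))}, IsUpperSet F → ∀ i, IsUpperSet {ω : SiteConfig (Site 2) | frameConfig i ω ∈ F} :=
    fun hF i ω ω' h hω => hF (frameConfig_mono i h) hω
  have lpre : ∀ {F : Set (SiteConfig (Site 2))}, IsUpperSet F → ∀ i, IsLowerSet {ω : SiteConfig (Site 2) | frameConfig i ωᶜ ∈ F} :=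
    fun hF i ω ω' h hω => hF (frameConfig_mono i (Set.compl_subset_compl.2 h)) hω
  have hAp_up : IsUpperSet Ap := huE.inter (upre huE 3)
  have hAm_lo : IsLowerSet Am := (lpre huE 2).inter (lpre huE 5)
  have hBp_up : IsUpperSet Bp := huC.inter (upre huC 3)
  have hBm_lo : IsLowerSet Bm := by
    refine IsLowerSet.inter (fun ω ω' h hω => huBt (Set.compl_subset_compl.2 h) hω) (fun ω ω' h hω => huBt ?_ hω)
    exact Set.compl_subset_compl.2 (rotConfig_mono 3 h)
  -- locality of the arms
  have dE : DeterminedBy E (sepConeSupport m N) := by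
    rw [hE, ← sepOpenArmIn_univ]; exact determinedBy_sepOpenArmIn univ (by omega) (by omega)
  have dEf := fun i => determinedBy_preimage_frameConfig i dE
  have dEfc : ∀ i, DeterminedBy {ω : SiteConfig (Site 2) | frameConfig i ωᶜ ∈ E} (frameIso i '' sepConeSupport m N) := fun i => by
    have h2 : {ω : SiteConfig (Site 2) | frameConfig i ωᶜ ∈ E} =
        {ω : SiteConfig (Site 2) | ωᶜ ∈ {χ : SiteConfig (Site 2) | frameConfig i χ ∈ E}} := by
      ext ω; simp only [Set.mem_setOf_eq]
    rw [h2]; exact DeterminedBy.preimage_compl' (dEf i)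
  have hE0 : {ω : SiteConfig (Site 2) | frameConfig 0 ω ∈ E} = E := by
    ext ω; simp only [Set.mem_setOf_eq, frameConfig_zero]
  have dAp : DeterminedBy Ap (↑S ∪ ↑P) := by
    refine DeterminedBy.inter ?_ ((dEf 3).mono ((coneSup 3 (by norm_num)).1 (Or.inr rfl)))
    have := (dEf 0).mono ((coneSup 0 (by norm_num)).1 (Or.inl rfl))
    rwa [hE0] at this
  have dAm : DeterminedBy Am (↑S ∪ ↑M) :=
    ((dEfc 2).mono ((coneSup 2 (by norm_num)).2 (Or.inl rfl))).inter ((dEfc 5).mono ((coneSup 5 (by norm_num)).2 (Or.inr rfl)))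
  -- locality of the corridors
  set FC : Finset (Site 2) := sepInCorrQFinset m m' ∪ sepOutCorrQFinset N N' with hFC
  have dC : DeterminedBy C ↑FC := by
    rw [hFC, Finset.coe_union]
    exact ((determinedBy_sepInCorrQ m m').mono Set.subset_union_left).inter ((determinedBy_sepOutCorrQ N N').mono Set.subset_union_right)
  have hFCP : ∀ (i : ℕ) (hi : i < 6), i = 0 ∨ i = 3 → frameIso i '' (↑FC : Set (Site 2)) ⊆ ↑P := by
    intro i hi hi0
    rw [hFC, Finset.coe_union, Set.image_union]
    exact Set.union_subset (inSup i hi hi0) (outSup i hi hi0)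
  have hC0 : {ω : SiteConfig (Site 2) | frameConfig 0 ω ∈ C} = C := by
    ext ω; simp only [Set.mem_setOf_eq, frameConfig_zero]
  have dCf := fun i => determinedBy_preimage_frameConfig i dC
  have dBp : DeterminedBy Bp ↑P := by
    refine DeterminedBy.inter ?_ ((dCf 3).mono (hFCP 3 (by norm_num) (Or.inr rfl)))
    have := (dCf 0).mono (hFCP 0 (by norm_num) (Or.inl rfl))
    rwa [hC0] at this
  set FB : Finset (Site 2) := inBentFinset m m' ∪ outBentFinset N N' with hFB
  have dBt : DeterminedBy Bt ↑FB := by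
    rw [hFB, Finset.coe_union]
    exact ((determinedBy_inBent m m').mono Set.subset_union_left).inter ((determinedBy_outBent N N').mono Set.subset_union_right)
  have hBm2 : {ω : SiteConfig (Site 2) | (rotConfig 3 ω)ᶜ ∈ Bt} = {ω : SiteConfig (Site 2) | ωᶜ ∈ rotConfig 3 ⁻¹' Bt} := by
    ext ω; simp only [Set.mem_setOf_eq, Set.mem_preimage, rotConfig_compl]
  have dBm : DeterminedBy Bm ↑M := by
    refine DeterminedBy.inter ((DeterminedBy.preimage_compl' dBt).mono ?_) ?_
    · rw [hFB, Finset.coe_union]; exact bendSup0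
    · rw [hBm2]
      refine (DeterminedBy.preimage_compl' (determinedBy_preimage_rotConfig 3 dBt)).mono ?_
      rw [hFB, Finset.coe_union]; exact bendSup3
  have fkg := triSitePercolation_locallyMonotone_fkg p hSP hSM hPM hAp_up hAm_lo hBp_up hBm_lo dAp dAm dBp dBm
  -- the corridor probabilities
  have hCq : ∀ q : unitInterval, (q = p ∨ q = unitInterval.symm p) → c ^ 93 * c ^ 95 ≤ (triSitePercolation q).real C := by
    intro q hq
    have h1 := le_real_sepInCorrQ_at q (hrsw q hq) hρ hc hm' hmm' hm3 (by omega : m ≤ Ncap)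
    have h2 := le_real_sepOutCorrQ_at' q (hrsw q hq) (by omega) hc hN (by omega) hN'N hcap
    have har := sitePercolation_harris' q (determinedBy_sepInCorrQ m m') (determinedBy_sepOutCorrQ N N')
      (isUpperSet_sepInCorrQ m m') (isUpperSet_sepOutCorrQ N N')
    unfold triSitePercolation at h1 h2 ⊢
    exact (mul_le_mul h1 h2 (pow_nonneg hc _) measureReal_nonneg).trans har
  have hBtq : ∀ q : unitInterval, (q = p ∨ q = unitInterval.symm p) → c ^ 97 * c ^ 95 ≤ (triSitePercolation q).real Bt := by
    intro q hq
    have h1 := le_real_inBent_at q (hrsw q hq) (by omega) hc hm' hmm' hm3 (by omega : m ≤ Ncap)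
    have h2 := le_real_outBent_at q (hrsw q hq) (by omega) hc hN hNN' hN'N hcap
    have har := sitePercolation_harris' q (determinedBy_inBent m m') (determinedBy_outBent N N')
      (isUpperSet_inBent m m') (isUpperSet_outBent N N')
    unfold triSitePercolation at h1 h2 ⊢
    exact (mul_le_mul h1 h2 (pow_nonneg hc _) measureReal_nonneg).trans har
  have hCC : 0 ≤ c ^ 93 * c ^ 95 := mul_nonneg (pow_nonneg hc _) (pow_nonneg hc _)
  have hBB : 0 ≤ c ^ 97 * c ^ 95 := mul_nonneg (pow_nonneg hc _) (pow_nonneg hc _)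
  have hBp_ge : (c ^ 93 * c ^ 95) ^ 2 ≤ (triSitePercolation p).real Bp := by
    have h3 : (triSitePercolation p).real {ω : SiteConfig (Site 2) | frameConfig 3 ω ∈ C} = (triSitePercolation p).real C :=
      real_preimage_frameConfig p 3 C
    have d3' : DeterminedBy {ω : SiteConfig (Site 2) | frameConfig 3 ω ∈ C} ↑(FC.image (frameIso 3)) := by
      rw [Finset.coe_image]; exact dCf 3
    have har := sitePercolation_harris' p dC d3' huC (upre huC 3)
    unfold triSitePercolation at h3 hCq ⊢
    rw [h3] at har
    have h1 := hCq p (Or.inl rfl)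
    calc (c ^ 93 * c ^ 95) ^ 2 = (c ^ 93 * c ^ 95) * (c ^ 93 * c ^ 95) := sq _
      _ ≤ (sitePercolation (Site 2) p).real C * (sitePercolation (Site 2) p).real C := mul_le_mul h1 h1 hCC measureReal_nonneg
      _ ≤ _ := har
  have hBm_ge : (c ^ 97 * c ^ 95) ^ 2 ≤ (triSitePercolation p).real Bm := by
    set q := unitInterval.symm p with hq
    have heq : Bm = compl ⁻¹' (Bt ∩ rotConfig 3 ⁻¹' Bt) := by
      ext ω
      simp only [hBm, Set.mem_inter_iff, Set.mem_setOf_eq, Set.mem_preimage, rotConfig_compl]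
    have hcmp := sitePercolation_real_preimage_compl p (Bt ∩ rotConfig 3 ⁻¹' Bt)
    have h3 : (triSitePercolation q).real (rotConfig 3 ⁻¹' Bt) = (triSitePercolation q).real Bt := real_preimage_rotConfig q 3 Bt
    have d3' : DeterminedBy (rotConfig 3 ⁻¹' Bt) ↑(FB.image (triRotIsoPow 3)) := by
      rw [Finset.coe_image]; exact determinedBy_preimage_rotConfig 3 dBt
    have u3 : IsUpperSet (rotConfig 3 ⁻¹' Bt) := fun ω ω' h hω => huBt (rotConfig_mono 3 h) hω
    have har := sitePercolation_harris' q dBt d3' huBt u3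
    unfold triSitePercolation at h3 hBtq hcmp ⊢
    rw [h3] at har
    rw [heq, hcmp]
    have h1 := hBtq q (Or.inr rfl)
    calc (c ^ 97 * c ^ 95) ^ 2 = (c ^ 97 * c ^ 95) * (c ^ 97 * c ^ 95) := sq _
      _ ≤ (sitePercolation (Site 2) q).real Bt * (sitePercolation (Site 2) q).real Bt := mul_le_mul h1 h1 hBB measureReal_nonneg
      _ ≤ _ := har
  -- assemble
  have hAA : sepFourArmQ m N = Ap ∩ Am := by
    ext ω; simp only [sepFourArmQ, hAp, hAm, hE, Set.mem_setOf_eq, Set.mem_inter_iff]; tauto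
  have hsub : Ap ∩ Am ∩ (Bp ∩ Bm) ⊆ sepFourArm m' N' := by
    rintro ω ⟨⟨⟨h0, h3⟩, h2, h5⟩, ⟨⟨hC0', hC3⟩, hB0, hB3⟩⟩
    simp only [Set.mem_setOf_eq] at h3 h2 h5 hC3 hB0 hB3
    have hN2 : 2 * N ≤ N' := by omega
    have a0 : ω ∈ sepOpenArm m' N' := openArm_halfStep hm' hmm' hm3 hN hmN hN2 hN'N ⟨⟨h0, hC0'.1⟩, hC0'.2⟩
    have a3 : frameConfig 3 ω ∈ sepOpenArm m' N' := openArm_halfStep hm' hmm' hm3 hN hmN hN2 hN'N ⟨⟨h3, hC3.1⟩, hC3.2⟩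
    have a1 : rotConfig 1 ωᶜ ∈ sepOpenArm m' N' := closedArm_halfStep hm' hmm' hm3 hN hmN hNN' hN'N h2 hB0.1 hB0.2
    rw [rotConfig_compl] at hB3
    rw [frameConfig_five_eq] at h5
    have a4 : rotConfig 1 (rotConfig 3 ωᶜ) ∈ sepOpenArm m' N' := closedArm_halfStep hm' hmm' hm3 hN hmN hNN' hN'N h5 hB3.1 hB3.2
    rw [rotConfig_one_three] at a4
    rw [frameConfig_three_eq_rotConfig] at a3
    exact sepFourArm_of_arms (by omega) (by omega) (by rw [rotConfig_zero_eq]; exact a0) a3 a1 a4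
  have h0 : 0 ≤ (triSitePercolation p).real (sepFourArmQ m N) := measureReal_nonneg
  calc (triSitePercolation p).real (sepFourArmQ m N) * ((c ^ 93 * c ^ 95) ^ 2 * (c ^ 97 * c ^ 95) ^ 2)
      ≤ (triSitePercolation p).real (Ap ∩ Am) * ((triSitePercolation p).real Bp * (triSitePercolation p).real Bm) := by
        rw [hAA]
        exact mul_le_mul_of_nonneg_left (mul_le_mul hBp_ge hBm_ge (pow_nonneg hBB 2) measureReal_nonneg) (by rw [← hAA]; exact h0)
    _ ≤ (triSitePercolation p).real (Ap ∩ Am ∩ (Bp ∩ Bm)) := fkg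
    _ ≤ (triSitePercolation p).real (sepFourArm m' N') := measureReal_mono hsub (measure_ne_top _ _)

end Literature.Probability.Percolation
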